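import Summits.HodgeConjecture.HodgeConjecture.Theorems.Ring2AbelianAllWeilTwistedProducts
import Literature.AlgebraicGeometry.VanGeemen1994.WeilKFrame
import Literature.AlgebraicGeometry.VanGeemen1994.WeilDiscriminantOfProductTop
import Literature.AlgebraicGeometry.HodgeTheory.WeilClassesTwistedSquare
import Literature.AlgebraicGeometry.HodgeTheory.WeilTypeAbelianVariety
import Literature.AlgebraicGeometry.HodgeTheory.AlgebraicClassesHodgeTypeHolds
import Literature.AlgebraicGeometry.HodgeTheory.StablyNondegenerateProducts
import Literature.AlgebraicGeometry.HodgeTheory.AbelianVarietyPullbackQuadratic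
import Literature.AlgebraicGeometry.ComplexMultiplication.EndomorphismFieldNondegenerateType
import Literature.AlgebraicGeometry.Motives.SegreHyperplaneClassProdWeighted
import HarnessLib

/-!
# Ring 2 · AbelianAll — ANDRÉ AXIS, PART O-a: THE ANCHORS `B × B̄` IN THE KERNEL —
  every twisted square `(T × T, φ × (−φ))` is of Weil type, and polarized by `L ⊠ L^{⊗m}` it has discriminant class `[(−m)^g]`
  (owed item (o155); abelian-variety level)

HONEST FRAMING (sub-cell `pub-hodge-ring2-ab-*`, verbatim): research route, not a corollary; conditional on HC_CM plus
one named minimal statement. (Cell `pub-hodge-ring2`, verbatim: research route conditional on HC_CM; not a corollary;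
Q11.4-sentence-2 already refuted in dim ≥ 3.) `HC_CM` does not occur in this file. No definition, no named fact, no
`sorry`; ABELIAN-VARIETY level (no pencil). Everything is proved on the carriers; the only inputs are tree theorems.

CONTEXT. Parts M-c/M-d/N (gens 43–44) reduced `B⋆` of the 7-fold total space of a compact pencil of `ℚ(√−d)`-Weil sixfolds
with its `K`-action to the Weil Hodge conjecture for EVERY member as soon as ONE chart is an unconditional ANCHOR (a chart
satisfying HC), and RING2-MAP AA2.361/AA2.366 (b) named — ON PAPER ONLY — the anchors on the NON-split components: the twisted
squares `B × B̄ = (B × B, φ × (−φ))` of CM threefolds `B` (and `E³ × Ē³`), polarized by `aθ ⊞ bθ`, «component `a ≡ λ`, every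
class». The owed item (o155) asked for the typed Weil structure and discriminant of `B × B̄` on the carriers. This file supplies
them, for EVERY complex abelian variety `T` of dimension `g` with `φ ≫ φ = −d` (`d ≥ 1`; ANY multiplicities `(n′, n″)` of
`K = ℚ(√−d)` on `H^{1,0}(T)`), `Φ = φ × (−φ) = prodLift (fst ≫ φ) (snd ≫ (−φ))`; part O-b draws the NON-split consequences.

* §1 **`isWeilType_twistedSquare` — `(T × T, Φ)` is of Weil type `(g, d)`** (van Geemen 4.9): the tree's
  `exists_mem_weilClassesPlus_twistedSquare_algebraic_ne_zero` gives a non-zero ALGEBRAIC class on the Weil line `E₊`, algebraic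
  classes are of Hodge type `(g, g)` (`isOfHodgeType_of_mem_algebraicClasses_of_isSmoothProjective`), and Deligne–Milne 4.4 (⇒)
  (`isWeilType_of_weilClass_ne_zero`). The Weil plane of `T × T̄` is ALGEBRAIC (tree: `weilClassesOf_twistedSquare_le_algebraicClasses`); when `dim T` is PRIME with a number
  field of degree `2 dim T` in `End⁰(T)` (a CM threefold `B`; `E³`) **HC holds for `T × T`** (`hodgeConjectureFor_twistedSquare_of_endField`:
  `T` is stably nondegenerate — Yanai / Tate–Murasaki, the tree's `EndFieldFullDegree.isStablyNondegenerate_of_prime`; `T × T = T.powSucc 1`).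
* §2 `exists_weightedSegreEmbedding_self_prod` — ONE projective embedding `e_T` of `T` (class `h = e_T^*a`) and, for every weight
  `m ≥ 1`, a projective embedding of `T × T` with hyperplane class `pr₁^*h + m·pr₂^*h` (Segre with the `(m−1)`-st Segre power;
  Hartshorne II Ex. 5.11–5.12), so that ONE `K`-frame of `(T, φ, h_K)` serves both factors.
* §3 `det_weilGramMatrix_neg_left_fin` — the Gram matrix of `(T, −φ, h)` in one rational `K`-frame is `−a + b√−d = −σ(Ψ)`, so
  `det Ψ(−a, b) = (−1)^k σ(det Ψ(a, b))`, ANY size `k` (ab-weil-1's `det_weilGramMatrix_neg_left`: even `k`); classes in `ℚˣ/Nm(K_dˣ)`: squares are `1`,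
  `[v^{2k+1}] = [v]`, `[−u] ≠ [−1] ⟺ u ∉ Nm(K_dˣ)`, **every NEGATIVE class is `[−m]`, `m ∈ ℕ`** (`exists_nat_mk_neg_eq`).
* §4 **`exists_hasWeilDiscriminantNondeg_twistedSquare` — THE DISCRIMINANT OF THE POLARIZED TWISTED SQUARE**: for `dim T = g ≥ 2`
  the `K`-symmetrised class of the weight-`m` Segre embedding of `(T × T, Φ)` is `pr₁^*h_K + m·pr₂^*h_K` and carries a
  NON-DEGENERATE discriminant witness (`VanGeemen1994.HasWeilDiscriminantNondeg`) of class **`[(−m)^g] ∈ ℚˣ/Nm(K_dˣ)`**: one `K`-frame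
  `(x, ω, a, b, q, t)` of `(T, φ, h_K)` (ab-weil-2's `exists_kFrame_ksymm`, any rank) on both factors, Gram data `(−a, b)` and
  `det = (−1)^g q` on the second, «`det H` is multiplicative» (`hasWeilDiscriminantNondeg_prod_of_kFrames`, any ranks):
  `[(C m t)^g (C t)^g q · (−1)^g q] = [(−m)^g · (C^g t^g q)²] = [(−m)^g]` (`C = C(2g−1, g−1) = C(2g−1, g)`). This is the kernel form
  of the pen-and-paper sentence «`det(aH ⊕ b(−H̄)) = (−1)^g (ab)^g (det H)² ≡ −ab` for `g` odd» of the ladder's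
  `WeilTypeLadderTwistedSquares` docstring («discriminants are not on the carriers»); `g = 1`: ab-weil-1's `…_cmSquare`.

HONEST REMARKS. No case of the Hodge conjecture beyond the tree's (stably nondegenerate `T × T`; Weil classes of twisted squares)
is claimed; nothing minimal is claimed; N104 untouched. In the tree's ABSOLUTE convention `IsSplitWeilType` (SOME `K`-symmetrised
hyperplane class hyperbolic) every twisted square of an odd-dimensional `T` is split (weight `m = 1`: class `[−1]`; ab-weil-2's
`isSplitWeilType_prod_of_odd_dim`); the non-split statements of part O-b are about the POLARIZED pair with the FIXED class
`pr₁^*h_K + m·pr₂^*h_K`, `m ∉ Nm(K_dˣ)` — the convention of the cell's typed targets `Ring2.Hypotheses.WeilClassesComponent n d δ`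
and of the André-axis pencils (the relative polarization; parts L-a/L-g: the class is constant along the pencil).

## References

* [vanGeemen1994HodgeAV] B. van Geemen, LNM 1594 (1994), 4.9–4.10, 4.14, Lemma 5.2 (1)–(4), 5.3–5.4 and (5.4.1).
* [Markman2025SurveySecant] E. Markman, arXiv:2509.23403 (unrefereed), §1.1 and §11.5 Steps 1–2.
* [Hartshorne1977] R. Hartshorne, Algebraic Geometry (1977), II Ex. 5.11–5.12. [Schoen1998HodgeWeilAddendum] C. Schoen, §10.
* [Deligne1982HodgeCycles] P. Deligne (notes by J. Milne), LNM 900 (1982), §4 Prop. 4.4, (4.4)–(4.5), Remark 4.10.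
* [Gordon1999HodgeAVSurvey] B. Gordon (1999), Thm. 6.3 with Remark, Thm. 6.4, Thm. 7.5, Def. 7.6. [Yanai1985] Remark (p. 172).
* [Andre1996Motifs] Y. André, Publ. Math. IHÉS 83 (1996), §6.3 Lemme 6.3.1, Lemme 6.3.3 and Remarque 2 (pp. 31–33).
-/

set_option linter.dupNamespace false

noncomputable section

open CategoryTheory MonoidalCategory AlgebraicGeometry CartesianMonoidalCategory
open Literature.AlgebraicGeometry Literature.AlgebraicGeometry.Motives
open Literature.AlgebraicGeometry.Motives.SegreHyperplaneClass
open Literature.AlgebraicGeometry.HodgeTheory Literature.AlgebraicGeometry.VanGeemen1994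
open Literature.AlgebraicGeometry.ComplexMultiplication (EndFieldFullDegree.isStablyNondegenerate_of_prime)
open Literature.AlgebraicTopology.SingularHomology
open Literature.Geometry.Kaehler

namespace Summit.HodgeConjecture.HodgeConjecture.Ring2.AbelianAll
/-! ## §1 Every twisted square is of Weil type; HC at the prime-dimensional CM ones -/

section WeilType

variable {T : AbelianVariety ℂ} {g d : ℕ} {φ : T ⟶ T}

/-- **THE TWISTED SQUARE `(T × T, φ × (−φ))` OF EVERY ABELIAN VARIETY WITH `ℚ(√−d)`-MULTIPLICATION IS OF WEIL TYPE `(g, d)`**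
(`dim T = g ≥ 1`, `φ ≫ φ = −d`, `d ≥ 1`, ANY multiplicities of `φ^*` on `H^{1,0}(T)`): the Weil line `E₊(T × T, Φ)` carries a
non-zero ALGEBRAIC class (tree: `exists_mem_weilClassesPlus_twistedSquare_algebraic_ne_zero`), algebraic classes are of Hodge
type `(g, g)`, and a non-zero `(g, g)` Weil class forces Weil type (Deligne–Milne Prop. 4.4 ⇒, van Geemen 4.10).
For `T = B` a CM threefold this is the Weil sixfold `B × B̄` of the sister cell; for `T = E³`, Deligne's `E³ × Ē³`.
[cite: vanGeemen1994HodgeAV, 4.9–4.10] [cite: Deligne1982HodgeCycles, §4 Prop. 4.4 and Remark 4.10] [cite: Schoen1998HodgeWeilAddendum, §10] -/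
theorem isWeilType_twistedSquare (hg : 0 < g) (hT : T.dim = g) (hd : 0 < d) (hφ : φ ≫ φ = -(d • 𝟙 T)) :
    IsWeilType (T.prod T)
      (AbelianVariety.prodLift (AbelianVariety.fst T T ≫ φ) (AbelianVariety.snd T T ≫ (-φ))) g d := by
  obtain ⟨P, hP, hPa, hP0⟩ := exists_mem_weilClassesPlus_twistedSquare_algebraic_ne_zero hg hT hd hφ
  have hdim : (T.prod T).dim = 2 * g := dim_twistedSquare hT
  exact isWeilType_of_weilClass_ne_zero hg hd hdim (twistedSquare_comp_self hφ)
    (weilClassesPlus_le_weilClassesOf _ _ g d hP) hP0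
    (isOfHodgeType_of_mem_algebraicClasses_of_isSmoothProjective (isSmoothProjective_of_dim_eq' hdim) g hPa)

/-- `T × T` is of Weil type for `K = ℚ(√−d)` acting through `φ × (−φ)` (`dim T ≥ 1`). [cite: vanGeemen1994HodgeAV, 4.9] -/
theorem weilType_twistedSquare (hT : 0 < T.dim) (hd : 0 < d) (hφ : φ ≫ φ = -(d • 𝟙 T)) : WeilType (T.prod T) :=
  ⟨T.dim, d, _, isWeilType_twistedSquare hT rfl hd hφ⟩

/-- **THE HODGE CONJECTURE FOR `T × T` WHEN `dim T` IS PRIME AND `End⁰(T)` CONTAINS A NUMBER FIELD OF DEGREE `2 dim T`**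
(a simple CM threefold `B`: the anchor `B × B̄ ≅ B²`; `E³`): `T` is stably nondegenerate UNCONDITIONALLY (Yanai's nondegeneracy
in prime dimension / Tate–Murasaki for `Eᵖ`, the tree's `EndFieldFullDegree.isStablyNondegenerate_of_prime`), so `Hdg = Div` on
`T × T = T.powSucc 1` and Lefschetz `(1,1)` concludes. [cite: Gordon1999HodgeAVSurvey, Thm. 6.3 with Remark, Thm. 6.4, Thm. 7.5 (1) and Def. 7.6]
[cite: Yanai1985, Remark (p. 172)] -/
theorem hodgeConjectureFor_twistedSquare_of_endField {F : Type} [Field F] [NumberField F]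
    (ιF : F →+* T.endAlgebra) (hF : Module.finrank ℚ F = 2 * T.dim) (hp : T.dim.Prime) :
    HodgeConjectureFor (T.prod T).dim (T.prod T).X :=
  (EndFieldFullDegree.isStablyNondegenerate_of_prime ιF hF hp).hodgeConjectureFor_powSucc 1

/-- … hence every rational Hodge `(g, g)`-class of `T × T` — in particular every Weil class of ANY `K`-structure on it — is
algebraic, for such `T`. [cite: Gordon1999HodgeAVSurvey, Thm. 6.3 with Remark and Thm. 6.4] -/
theorem hodgeClass_algebraic_twistedSquare_of_endField {F : Type} [Field F] [NumberField F]
    (ιF : F →+* T.endAlgebra) (hF : Module.finrank ℚ F = 2 * T.dim) (hp : T.dim.Prime) (hT : T.dim = g)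
    {c : complexBetti (T.prod T).X (2 * g)} (hc : IsRationalClass c) (hH : IsOfHodgeType (2 * g) (T.prod T).X (2 * g) g g c) :
    c ∈ algebraicClasses (T.prod T).X g := by
  have h := hodgeConjectureFor_twistedSquare_of_endField ιF hF hp
  rw [dim_twistedSquare hT] at h
  exact h.2 g c hc hH

end WeilType

/-! ## §2 Weighted Segre embeddings of `T × T` with ONE embedding of `T` on both factors -/

section Segre

/-- **Weighted Segre embeddings of the square with equal factor data** (Hartshorne II Ex. 5.11–5.12, `𝒪(1, m)`): ONE projective
embedding `e_T` of `T` with a non-zero rational ambient class `a_T`, and for every weight `m ≥ 1` a projective embedding of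
`T × T` with hyperplane class `pr₁^*(e_T^*a_T) + m · pr₂^*(e_T^*a_T)` (Segre of `e_T` with `s_{m−1}(e_T)`). The two-embedding form
is the tree's `Motives.exists_weightedSegreEmbedding_prod`; here the SAME `(e_T, a_T)` on both factors, so that one `K`-frame of
`(T, φ, h_K)` serves both. [cite: Hartshorne1977, II Ex. 5.11 and Ex. 5.12] [cite: Markman2025SurveySecant, §11.5 Step 2] -/
theorem exists_weightedSegreEmbedding_self_prod (T : AbelianVariety ℂ) :
    ∃ (eT : ProjectiveEmbedding T.X) (aT : complexBetti (projectiveSpace eT.n ℂ) 2),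
      IsRationalClass aT ∧ aT ≠ 0 ∧
      ∀ m : ℕ, 0 < m →
        ∃ (e : ProjectiveEmbedding (T.prod T).X) (a : complexBetti (projectiveSpace e.n ℂ) 2),
          IsRationalClass a ∧ a ≠ 0 ∧
          complexBetti.map e.ι 2 a =
            complexBetti.map (AbelianVariety.fst T T).hom.hom.hom 2 (complexBetti.map eT.ι 2 aT) +
            ((m : ℕ) : ℂ) • complexBetti.map (AbelianVariety.snd T T).hom.hom.hom 2 (complexBetti.map eT.ι 2 aT) := by
  obtain ⟨g, hgr, hgnz, hgσ⟩ := exists_segreHyperplaneClasses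
  obtain ⟨N, e₀, hN, he₀⟩ := exists_closedImmersion_projectiveSpace_pos T
  haveI := he₀
  refine ⟨⟨N, e₀, he₀⟩, g N, hgr N, hgnz N hN, fun m hm ↦ ?_⟩
  obtain ⟨d₁, rfl⟩ : ∃ d, m = d + 1 := ⟨m - 1, by omega⟩
  obtain ⟨ιB, hιB⟩ : ∃ ι : T.X ⟶ projectiveSpace (ProjectiveSpace.segrePowDim N d₁) ℂ,
      ι = e₀ ≫ ProjectiveSpace.segrePow N ℂ d₁ := ⟨_, rfl⟩
  haveI := isClosedImmersion_segrePow_left N d₁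
  haveI hιBci : IsClosedImmersion ιB.left := by
    rw [hιB]
    change IsClosedImmersion (e₀.left ≫ (ProjectiveSpace.segrePow N ℂ d₁).left)
    infer_instance
  obtain ⟨ι, hι⟩ : ∃ ι : T.X ⊗ T.X ⟶
      projectiveSpace (N * ProjectiveSpace.segrePowDim N d₁ + N + ProjectiveSpace.segrePowDim N d₁) ℂ,
      ι = (e₀ ⊗ₘ ιB) ≫ segreEmbedding _ _ ℂ := ⟨_, rfl⟩
  haveI := isClosedImmersion_tensorHom_left (X := T.X) (Y := T.X) e₀ ιB
  have hιci : IsClosedImmersion ι.left := by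
    rw [hι]
    change IsClosedImmersion ((e₀ ⊗ₘ ιB).left ≫ (segreEmbedding _ _ ℂ).left)
    infer_instance
  have hKK : 1 ≤ N * ProjectiveSpace.segrePowDim N d₁ + N + ProjectiveSpace.segrePowDim N d₁ :=
    le_trans hN ((Nat.le_add_left _ _).trans (Nat.le_add_right _ _))
  refine ⟨⟨_, ι, hιci⟩, g _, hgr _, hgnz _ hKK, ?_⟩
  have hBcl : complexBetti.map ιB 2 (g _) = ((d₁ + 1 : ℕ) : ℂ) • complexBetti.map e₀ 2 (g N) := by
    rw [hιB, map_comp_apply', map_segrePow_of_additive g hgσ N d₁, map_smul]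
  have final : complexBetti.map ι 2 (g _) =
      complexBetti.map (fst T.X T.X) 2 (complexBetti.map e₀ 2 (g N)) +
        ((d₁ + 1 : ℕ) : ℂ) • complexBetti.map (snd T.X T.X) 2 (complexBetti.map e₀ 2 (g N)) := by
    rw [hι, map_comp_apply', hgσ, map_add, map_tensorHom_map_fst, map_tensorHom_map_snd, hBcl, map_smul]
  exact final

end Segre

/-! ## §3 The Gram determinant of the conjugate structure, any rank; classes in `ℚˣ/Nm(K_dˣ)` -/

section Gram

/-- **`det Ψ(−a, b) = (−1)^k · σ(det Ψ(a, b))` for a frame of ANY size `k`** (`Ψ(−a, b) = −a + b√−d = −σ(Ψ(a, b))`, `σ` the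
conjugation of `K_d`; ab-weil-1's `det_weilGramMatrix_neg_left` is the case `k = 2n`). [cite: vanGeemen1994HodgeAV, Lemma 5.2 (2)–(3)] -/
theorem det_weilGramMatrix_neg_left_fin (d : ℕ) {k : ℕ} (a b : Matrix (Fin k) (Fin k) ℚ) :
    (weilGramMatrix d (-a) b).det =
      algebraMap ℚ (weilField d) ((-1) ^ k) * weilFieldHom d d (-1) (weilField_conj_datum d) (weilGramMatrix d a b).det := by
  have e : weilGramMatrix d (-a) b = weilGramMatrix d ((-1 : ℚ) • a) ((-1 : ℚ) • ((-1 : ℚ) • b)) := by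
    congr 1 <;> simp
  rw [e, det_weilGramMatrix_smul, AlgHom.map_det, weilFieldHom_mapMatrix_weilGramMatrix]

/-- … so a rational Gram determinant `det Ψ(a, b) = q` gives `det Ψ(−a, b) = (−1)^k q`.
[cite: vanGeemen1994HodgeAV, Lemma 5.2 (2)–(3)] -/
theorem det_weilGramMatrix_neg_left_of_det_eq (d : ℕ) {k : ℕ} {a b : Matrix (Fin k) (Fin k) ℚ} {q : ℚ}
    (hq : (weilGramMatrix d a b).det = algebraMap ℚ (weilField d) q) :
    (weilGramMatrix d (-a) b).det = algebraMap ℚ (weilField d) ((-1) ^ k * q) := by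
  rw [det_weilGramMatrix_neg_left_fin, hq, weilFieldHom_algebraMap, ← map_mul]

/-- Classes in `ℚˣ/Nm(K_dˣ)` see rational squares as `1`: `(W) = (w)` whenever `W = w · u²`.
[cite: vanGeemen1994HodgeAV, 4.14] -/
theorem weilNormResidueGroup_mk_eq_mk_of_val_eq {d : ℕ} {W w : ℚˣ} (u : ℚˣ) (h : (W : ℚ) = w * (u : ℚ) ^ 2) :
    (QuotientGroup.mk W : weilNormResidueGroup d) = QuotientGroup.mk w := by
  have hWu : W = w * u ^ 2 := Units.ext (by rw [h, Units.val_mul, Units.val_pow_eq_pow_val])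
  rw [hWu, QuotientGroup.mk_mul, (QuotientGroup.eq_one_iff _).2 (sq_mem_normUnitsSubgroup_weilField d u), mul_one]

/-- Odd powers: `[(−u)^{2k+1}] = [−u]` in the `2`-torsion group `ℚˣ/Nm(K_dˣ)`. [cite: vanGeemen1994HodgeAV, 4.14] -/
theorem weilNormResidueGroup_mk_pow_odd {d : ℕ} (v : ℚˣ) (k : ℕ) :
    (QuotientGroup.mk (v ^ (2 * k + 1)) : weilNormResidueGroup d) = QuotientGroup.mk v := by
  have e : v ^ (2 * k + 1) = (v ^ k) ^ 2 * v := by rw [pow_succ, pow_mul']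
  rw [e, QuotientGroup.mk_mul, (QuotientGroup.eq_one_iff _).2 (sq_mem_normUnitsSubgroup_weilField d _), one_mul]

/-- Even powers: `[v^{2k}] = 1`. [cite: vanGeemen1994HodgeAV, 4.14] -/
theorem weilNormResidueGroup_mk_pow_even {d : ℕ} (v : ℚˣ) (k : ℕ) :
    (QuotientGroup.mk (v ^ (2 * k)) : weilNormResidueGroup d) = 1 := by
  have e : v ^ (2 * k) = (v ^ k) ^ 2 := by rw [pow_mul']
  rw [e, (QuotientGroup.eq_one_iff _).2 (sq_mem_normUnitsSubgroup_weilField d _)]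

/-- `[−u] ≠ [−1]` iff `u ∉ Nm(K_dˣ)`. [cite: vanGeemen1994HodgeAV, 4.14 and (5.4.1)] -/
theorem weilNormResidueGroup_mk_neg_ne_mk_neg_one_iff {d : ℕ} (u : ℚˣ) :
    (QuotientGroup.mk (-u) : weilNormResidueGroup d) ≠ QuotientGroup.mk (-1) ↔ u ∉ normUnitsSubgroup ℚ (weilField d) := by
  rw [Ne, QuotientGroup.eq, not_iff_not]
  have e : (-u)⁻¹ * (-1 : ℚˣ) = u⁻¹ := Units.ext (by simp)
  rw [e, Subgroup.inv_mem_iff]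

/-- **Every NEGATIVE class of `ℚˣ/Nm(K_dˣ)` is `[−m]` for a positive integer `m`** (`q = num/den < 0`, `m = |num|·den`,
`q⁻¹ · (−m) = den²`). [cite: vanGeemen1994HodgeAV, 4.14 and 5.3] -/
theorem exists_nat_mk_neg_eq {d : ℕ} (q : ℚˣ) (hq : (q : ℚ) < 0) :
    ∃ (m : ℕ) (hm : 0 < m),
      (QuotientGroup.mk (-Units.mk0 (m : ℚ) (Nat.cast_ne_zero.2 hm.ne')) : weilNormResidueGroup d) = QuotientGroup.mk q := by
  obtain ⟨N, hN⟩ : ∃ N : ℤ, (q : ℚ).num = N := ⟨_, rfl⟩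
  obtain ⟨D, hD⟩ : ∃ D : ℕ, (q : ℚ).den = D := ⟨_, rfl⟩
  have hNneg : N < 0 := by rw [← hN]; exact Rat.num_neg.2 hq
  have hDpos : 0 < D := by rw [← hD]; exact (q : ℚ).den_pos
  have hqND : (q : ℚ) = (N : ℚ) / (D : ℚ) := by rw [← hN, ← hD]; exact (Rat.num_div_den (q : ℚ)).symm
  have hm : 0 < N.natAbs * D := Nat.mul_pos (Int.natAbs_pos.2 hNneg.ne) hDpos
  refine ⟨N.natAbs * D, hm, QuotientGroup.eq.2 ?_⟩
  have hD0 : (D : ℚ) ≠ 0 := Nat.cast_ne_zero.2 hDpos.ne'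
  have hN0 : (N : ℚ) ≠ 0 := by exact_mod_cast hNneg.ne
  have habs : ((N.natAbs : ℕ) : ℚ) = -(N : ℚ) := by
    rw [← Int.cast_natCast, Int.ofNat_natAbs_of_nonpos hNneg.le, Int.cast_neg]
  have hu : (-Units.mk0 ((N.natAbs * D : ℕ) : ℚ) (Nat.cast_ne_zero.2 hm.ne'))⁻¹ * q =
      (Units.mk0 (D : ℚ) hD0)⁻¹ ^ 2 := by
    ext
    simp only [Units.val_mul, Units.val_inv_eq_inv_val, Units.val_neg, Units.val_mk0, Units.val_pow_eq_pow_val,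
      Nat.cast_mul, habs, hqND]
    field_simp
  rw [hu]
  exact sq_mem_normUnitsSubgroup_weilField d _

end Gram

/-! ## §4 The discriminant class of the polarized twisted square `(T × T, φ × (−φ), L ⊠ L^{⊗m})` -/

section Discriminant

variable {T : AbelianVariety ℂ} {m₀ d : ℕ} {φ : T ⟶ T}

/-- **THE DISCRIMINANT OF THE POLARIZED TWISTED SQUARE.** Let `T` be a complex abelian variety of dimension `g = m₀ + 1 ≥ 2`,
`φ ≫ φ = −(d • 𝟙 T)`, `d ≥ 1`, `Φ = φ × (−φ)` on `T × T`. There is ONE projective embedding `e_T` of `T` with a non-zero rational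
ambient class `a_T` — `K`-symmetrised class `h_K = d·e_T^*a_T + φ^*e_T^*a_T` — such that for EVERY weight `m ≥ 1` some projective
embedding `e` of `T × T` with a rational `a ≠ 0` has `K`-symmetrised class `d·e^*a + Φ^*e^*a = pr₁^*h_K + m·pr₂^*h_K` carrying a
NON-DEGENERATE DISCRIMINANT WITNESS of class `[w] = [(−m)^g] ∈ ℚˣ/Nm(K_dˣ)` ((`w : ℚ) = (−m)^g`): one `K`-frame `(x, ω, a, b, q, t)`
of `(T, φ, h_K)` on both factors, Gram data `(−a, b)` with `det = (−1)^g q` for `−φ`, `det H` multiplicative in the product frame: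
`(C m t)^g (C t)^g · q · (−1)^g q = (−m)^g · (C^g t^g q)²`, `C = C(2g−1, g−1) = C(2g−1, g)`. The carrier form of
«`det(aH ⊕ b(−H̄)) = (−1)^g (ab)^g (det H)²`». [cite: vanGeemen1994HodgeAV, Lemma 5.2 (2)–(3), 4.14 and 5.3]
[cite: Markman2025SurveySecant, §11.5 Step 2] [cite: Hartshorne1977, II Ex. 5.11 and Ex. 5.12] -/
theorem exists_hasWeilDiscriminantNondeg_twistedSquare (hm₀ : 1 ≤ m₀) (hT : T.dim = m₀ + 1) (hd : 0 < d)
    (hφ : φ ≫ φ = -(d • 𝟙 T)) :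
    ∃ (eT : ProjectiveEmbedding T.X) (aT : complexBetti (projectiveSpace eT.n ℂ) 2),
      IsRationalClass aT ∧ aT ≠ 0 ∧
      ∀ m : ℕ, 0 < m →
        ∃ (e : ProjectiveEmbedding (T.prod T).X) (a : complexBetti (projectiveSpace e.n ℂ) 2) (w : ℚˣ),
          IsRationalClass a ∧ a ≠ 0 ∧ (w : ℚ) = (-(m : ℚ)) ^ (m₀ + 1) ∧
          (d : ℂ) • complexBetti.map e.ι 2 a +
              complexBetti.map (AbelianVariety.prodLift (AbelianVariety.fst T T ≫ φ)
                (AbelianVariety.snd T T ≫ (-φ))).hom.hom.hom 2 (complexBetti.map e.ι 2 a) =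
            complexBetti.map (AbelianVariety.fst T T).hom.hom.hom 2
                ((d : ℂ) • complexBetti.map eT.ι 2 aT + complexBetti.map φ.hom.hom.hom 2 (complexBetti.map eT.ι 2 aT)) +
              ((m : ℚ) : ℂ) • complexBetti.map (AbelianVariety.snd T T).hom.hom.hom 2
                ((d : ℂ) • complexBetti.map eT.ι 2 aT + complexBetti.map φ.hom.hom.hom 2 (complexBetti.map eT.ι 2 aT)) ∧
          HasWeilDiscriminantNondeg (T.prod T)
            (AbelianVariety.prodLift (AbelianVariety.fst T T ≫ φ) (AbelianVariety.snd T T ≫ (-φ))) (m₀ + 1) d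
            ((d : ℂ) • complexBetti.map e.ι 2 a +
              complexBetti.map (AbelianVariety.prodLift (AbelianVariety.fst T T ≫ φ)
                (AbelianVariety.snd T T ≫ (-φ))).hom.hom.hom 2 (complexBetti.map e.ι 2 a))
            (QuotientGroup.mk w) := by
  classical
  set Φ := AbelianVariety.prodLift (AbelianVariety.fst T T ≫ φ) (AbelianVariety.snd T T ≫ (-φ)) with hΦ
  have hψ : (-φ) ≫ (-φ) = -(d • 𝟙 T) := by rw [Preadditive.neg_comp_neg, hφ]
  -- (1) the Segre data and ONE `K`-frame of `(T, φ, h_K)`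
  obtain ⟨eT, aT, haT, haT0, hemb⟩ := exists_weightedSegreEmbedding_self_prod T
  obtain ⟨x, ω, am, bm, q, t, hx, hi, hω, hω0, hp, hq, ht⟩ := exists_kFrame_ksymm hm₀ hT hd hφ eT haT haT0
  set hK := (d : ℂ) • complexBetti.map eT.ι 2 aT + complexBetti.map φ.hom.hom.hom 2 (complexBetti.map eT.ι 2 aT)
    with hKdef
  refine ⟨eT, aT, haT, haT0, fun m hm ↦ ?_⟩
  have hmQ : (m : ℚ) ≠ 0 := Nat.cast_ne_zero.2 hm.ne'
  -- (2) the `K`-symmetrised class of the weight-`m` Segre embedding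
  have hKP : ∀ (e : ProjectiveEmbedding (T.prod T).X) (a : complexBetti (projectiveSpace e.n ℂ) 2),
      complexBetti.map e.ι 2 a =
        complexBetti.map (AbelianVariety.fst T T).hom.hom.hom 2 (complexBetti.map eT.ι 2 aT) +
          ((m : ℕ) : ℂ) • complexBetti.map (AbelianVariety.snd T T).hom.hom.hom 2 (complexBetti.map eT.ι 2 aT) →
      (d : ℂ) • complexBetti.map e.ι 2 a + complexBetti.map Φ.hom.hom.hom 2 (complexBetti.map e.ι 2 a) =
        complexBetti.map (AbelianVariety.fst T T).hom.hom.hom 2 hK +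
          complexBetti.map (AbelianVariety.snd T T).hom.hom.hom 2 ((((m : ℚ)) : ℂ) • hK) := by
    intro e a he
    rw [he, map_add, map_smul, map_prodLift_map_fst φ (-φ) 2, map_prodLift_map_snd φ (-φ) 2, map_neg_two, hKdef]
    simp only [map_add, map_smul, smul_add, smul_smul]
    push_cast
    module
  -- (3) the frame data of the SECOND factor `(T, −φ, m·h_K)`: Gram `(−a, b)`, top class `m^{m₀} ω`, top coefficient `m t`
  have hi' : LinearIndependent ℂ (Sum.elim x (fun i => complexBetti.map (-φ).hom.hom.hom 1 (x i))) := by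
    have e1 : (fun i => complexBetti.map (-φ).hom.hom.hom 1 (x i)) =
        fun i => (-1 : ℂ) • complexBetti.map φ.hom.hom.hom 1 (x i) := by
      funext i; rw [complexBetti_map_neg_one_apply, neg_one_smul]
    rw [e1]
    exact (linearIndependent_sum_elim_smul_iff _ _ (by norm_num)).2 hi
  have hp' : ∀ i j : Fin (m₀ + 1),
      polarizationPairingOne T.X ((((m : ℚ)) : ℂ) • hK) m₀ (x i) (complexBetti.map (-φ).hom.hom.hom 1 (x j)) =
          (((-am) i j : ℚ) : ℂ) • (((((m : ℚ) ^ m₀ : ℚ)) : ℂ) • ω) ∧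
        polarizationPairingOne T.X ((((m : ℚ)) : ℂ) • hK) m₀ (x i) (x j) =
          ((bm i j : ℚ) : ℂ) • (((((m : ℚ) ^ m₀ : ℚ)) : ℂ) • ω) := by
    intro i j
    obtain ⟨h1, h2⟩ := hp i j
    refine ⟨?_, ?_⟩
    · rw [complexBetti_map_neg_one_apply, map_neg, polarizationPairingOne_smul, h1]
      simp only [smul_smul, ← neg_smul, Matrix.neg_apply]
      congr 1
      push_cast
      ring
    · rw [polarizationPairingOne_smul, h2]
      simp only [smul_smul]
      congr 1
      push_cast
      ring
  have ht' : lefschetzPow ((((m : ℚ)) : ℂ) • hK) m₀ 2 ((((m : ℚ)) : ℂ) • hK) =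
      ((((m : ℚ) * t : ℚ)) : ℂ) • (((((m : ℚ) ^ m₀ : ℚ)) : ℂ) • ω) := by
    rw [HodgeRiemannDegreeOne.lefschetzPow_smul_self, ht, smul_smul, smul_smul]
    congr 1
    push_cast
    ring
  have hq' : (weilGramMatrix d (-am) bm).det =
      algebraMap ℚ (weilField d) ((((-1 : ℚˣ) ^ (m₀ + 1) * q : ℚˣ) : ℚ)) := by
    rw [det_weilGramMatrix_neg_left_of_det_eq d hq]
    push_cast
    rfl
  have hωr : IsRationalClass ((((((m : ℚ) ^ m₀ : ℚ)) : ℂ) • ω)) := hω.smul _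
  have hω0' : (((((m : ℚ) ^ m₀ : ℚ)) : ℂ) • ω) ≠ 0 := smul_ne_zero (by exact_mod_cast pow_ne_zero _ hmQ) hω0
  -- (4) the weight-`m` embedding; top coefficients do not vanish; the product witness
  obtain ⟨e, a, ha, ha0, he⟩ := hemb m hm
  have hh := hKP e a he
  have hN : 2 * (m₀ + 1) = m₀ + m₀ + 2 := by ring
  obtain ⟨ht0, htB0⟩ := prod_kFrames_top_ne_zero hT hT hN (kA := m₀ + 1) (kB := m₀ + 1) (by omega) (by omega)
    (by omega) hd hφ hψ x hx hi hK ω am bm hp t ht x hx hi' ((((m : ℚ)) : ℂ) • hK)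
    (((((m : ℚ) ^ m₀ : ℚ)) : ℂ) • ω) (-am) bm hp' ((m : ℚ) * t) ht' e ha ha0 hh
  let ε : Fin (m₀ + 1) ⊕ Fin (m₀ + 1) ≃ Fin (2 * (m₀ + 1)) := finSumFinEquiv.trans (finCongr (by omega))
  have hδ := hasWeilDiscriminantNondeg_prod_of_kFrames hT hT hN ε x hx hi hK ω hω hω0 am bm hp t ht ht0 q hq
    x hx hi' ((((m : ℚ)) : ℂ) • hK) (((((m : ℚ) ^ m₀ : ℚ)) : ℂ) • ω) hωr hω0' (-am) bm hp' ((m : ℚ) * t) ht'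
    htB0 ((-1 : ℚˣ) ^ (m₀ + 1) * q) hq'
  rw [← hh] at hδ
  -- (5) the class: `(C m t)^g (C t)^g q (−1)^g q = (−m)^g (C^g t^g q)²`
  have hC : (((2 * (m₀ + 1) - 1).choose (m₀ + 1) : ℕ) : ℚ) = (((2 * (m₀ + 1) - 1).choose m₀ : ℕ) : ℚ) := by
    rw [show 2 * (m₀ + 1) - 1 = 2 * m₀ + 1 by omega, Nat.choose_symm_half]
  have hC0 : (((2 * (m₀ + 1) - 1).choose m₀ : ℕ) : ℚ) ≠ 0 :=
    Nat.cast_ne_zero.2 (Nat.choose_pos (by omega)).ne'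
  have ht0' : t ≠ 0 := ht0
  set u : ℚˣ := Units.mk0 ((((2 * (m₀ + 1) - 1).choose m₀ : ℕ) : ℚ) * t) (mul_ne_zero hC0 ht0') ^ (m₀ + 1) * q with hu
  set w : ℚˣ := (-Units.mk0 (m : ℚ) hmQ) ^ (m₀ + 1) with hw
  refine ⟨e, a, w, ha, ha0, ?_, by rw [hh, map_smul], ?_⟩
  · rw [hw, Units.val_pow_eq_pow_val, Units.val_neg, Units.val_mk0]
  · rw [weilNormResidueGroup_mk_eq_mk_of_val_eq (w := w) u ?_] at hδ
    · exact hδ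
    rw [Units.val_mul, Units.val_mul, Units.val_mk0, Units.val_mul, Units.val_pow_eq_pow_val, Units.val_neg,
      Units.val_one, hw, hu, Units.val_mul, Units.val_pow_eq_pow_val, Units.val_pow_eq_pow_val, Units.val_neg,
      Units.val_mk0, Units.val_mk0, hC]
    ring

end Discriminant
end Summit.HodgeConjecture.HodgeConjecture.Ring2.AbelianAll

end
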